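import Summits.Langlands.Langlands.Theorems.PicardMuOrdinaryMuOrdinaryFamilyRTThorneCompanionsDebts
import HarnessLib

/-!
# Crux `MuOrdinaryFamilyRT` (stmt-Langlands-13757), line `thorne-minimal-lift`: the kernel-checked reduction
# of the registered stub `stub_companions` to its four typed debts (Reduction file of …ThorneCompanionsDebts)

The registered stub `T.stub_companions` (…ThorneDefs § 3) says: for every integral `Λ`-adic B-ordinary
polarized family `𝓕 : OrdFamily f ι e S₀ ρ_C` through the Picard point (generic `f`, main class, minimal
away from `3`, `4 ≤ dim 𝓕.R`, `𝓕.R` module-finite over `𝓕.Λ`) there are a Galois CM quadratic `F'/K`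
keeping the image of the heart, a level `S'`, a finite `E/ℚ₃` and a set `D` of `E`-integral weights
`κ : 𝓕.Λ → ℚ̄₃` accumulating `3`-adically at the weight of the Picard point, such that EVERY `ℚ̄₃`-point `y`
of `𝓕.R` over `D` has an ordinary automorphic companion over `F'` (`HasOrdinaryCompanion 𝓕 F' hcpt' S' y`).

The companion Defs file …ThorneCompanionsDebts (p147495) typed the four debts: MF1
`Missing.hidaOrdinaryCompanions` (THE WALL: Hida theory on the definite unitary group `U(3)_{F'/F'⁺}` at
`GL₃/F'`-level), MF2 `Missing.ordinaryPolarizedSeed` (the ordinary polarized residual-automorphy seed over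
`F'`), G1 `Missing.auxiliaryCMField` (the auxiliary biquadratic CM field) and G3
`Missing.arithmeticPointsNearPicard` (the Galois side: gap-dominant arithmetic weights near `x_C` and the
shape of the points over them).  This file (no definitions, proofs only) proves:

* § 1 audit lemmas.  `accumulation_nonempty`: the accumulation clause forces `D ≠ ∅` (so the junk
  witness `D = ∅`, which makes the companion clause vacuous, is dead).  `companion_picardPoint_of_mem`:
  if the Picard weight `κ_C = j ∘ x ∘ (Λ → R)` itself lay in `D`, the witness would owe a REGULAR
  ordinary companion to the Picard point `y_C = j ∘ x` (impossible in truth: clause (e) of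
  `HasOrdinaryCompanion` forces Hodge–Tate gaps `≥ 3` at every label, `ρ_C` has weights `{0,0,1}`), so
  `D` must avoid `κ_C` while accumulating at it.  `exists_point_over`: for a module-finite family of
  dimension `≥ 4` EVERY weight `κ : Λ → ℚ̄₃` has a point `y : R → ℚ̄₃` over it (lying over + extension
  of embeddings into the algebraically closed `ℚ̄₃`), so the companion clause is never vacuous: the
  wall is the existential `∃ Pc : CuspidalAutomorphicRepData 3 F' hcpt'` (Disproof F2).
* § 2 `stub_companions_of` — the registered statement follows from MF1 + MF2 + G1 + G3 by plumbing plus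
  two small lemmas (`isDominant_of_gaps`; `norm_cast_rbar_sub_pointRep_lt_one`, the entrywise residual
  congruence `ρ_y ≡ r̄_f^B` for continuous points), the entrywise chain of clause (d) being ultrametric.

Nothing here discharges a debt; G1 and G3 are registered stubs of the line (`stub_auxiliaryCMField`,
`stub_arithmeticPoints`).
-/

set_option linter.dupNamespace false

namespace Summit.Langlands.Langlands.Cruxes.MuOrdinaryFamilyRT.ThorneMinimalLift

open scoped NumberField Polynomial Matrix Classical
open Field IsDedekindDomain Polynomial
open Literature.NumberTheory.GaloisRepresentations Literature.NumberTheory.Automorphic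
open Summit.Langlands.Langlands.Cruxes.MuOrdinaryFamilyRT.CharZeroDominance

noncomputable section

/-! ## 1. Audit lemmas: which existentials of `T.stub_companions` are cheap and which is the wall -/

/-- **J1.** The accumulation clause `∀ M, ∃ κ ∈ D, …` of `T.stub_companions` forces `D` to be
non-empty: the junk witness `D = ∅` (which makes the companion clause `∀ y over D, …` vacuous) is not
available. -/
theorem accumulation_nonempty {α : Type*} {D : Set α} {P : ℕ → α → Prop}
    (h : ∀ M : ℕ, ∃ κ ∈ D, P M κ) : D.Nonempty := by
  obtain ⟨κ, hκ, -⟩ := h 0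
  exact ⟨κ, hκ⟩

variable {f : ℤ[X]} {ι : PadicAlgCl 3 ≃+* ℂ} {e : K →+* ℂ} {S₀ : Finset (HeightOneSpectrum (𝓞 K))}
  {ρC : FramedGaloisRep K (PadicAlgCl 3) 3}

/-- The accumulation target of `T.stub_companions` is the weight of the Picard point,
`κ_C = j ∘ x ∘ (Λ → R) : Λ → ℚ̄₃` — the weight at which `D` must accumulate (definitional unfolding; no
new definition is introduced for it). -/
theorem picardWeight_apply (𝓕 : OrdFamily f ι e S₀ ρC) (a : 𝓕.Λ) :
    ((𝓕.j.comp (𝓕.x : 𝓕.R →+* 𝓕.𝒪)).comp (algebraMap 𝓕.Λ 𝓕.R)) a =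
      𝓕.j (𝓕.x (algebraMap 𝓕.Λ 𝓕.R a)) :=
  rfl

/-- **J2.** If a witness of `T.stub_companions` put the Picard weight `κ_C = j ∘ x ∘ (Λ → R)` itself into
`D` (the cheapest way to satisfy the accumulation clause: distance `0`), it would owe an ordinary
automorphic companion to the Picard point `y_C = j ∘ x`, i.e. (clause (e) of `HasOrdinaryCompanion`) a
Borel frame of `ρ_C|Γ_{F'_w}` whose diagonal inertial characters are `∏_τ τ(Art⁻¹ ·)^{-(λ_{τ,3-i}+i-1)}` for
a dominant `λ` with gaps `≥ 2` — three characters with Hodge–Tate weights pairwise `≥ 3` apart at every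
label — whereas `𝓕.ends` makes two of them `1` and `ε^{±1}` on open inertia (weights `0` and `∓1`, one
apart).  So in truth `κ_C ∉ D`: `D` must accumulate at `κ_C` without containing it (hence be infinite);
recorded here as the formal obligation such a witness incurs. -/
theorem companion_picardPoint_of_mem (𝓕 : OrdFamily f ι e S₀ ρC)
    {F' : Type} [Field F'] [NumberField F'] [Algebra K F'] [IsGalois ℚ F']
    {hcpt' : isCompact_glFiniteIntegralLevel 3 F'} {S' : Finset (HeightOneSpectrum (𝓞 F'))}
    {D : Set (𝓕.Λ →+* PadicAlgCl 3)}
    (hD : ∀ y : 𝓕.R →+* PadicAlgCl 3, y.comp (algebraMap 𝓕.Λ 𝓕.R) ∈ D →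
      HasOrdinaryCompanion 𝓕 F' hcpt' S' y)
    (hmem : (𝓕.j.comp (𝓕.x : 𝓕.R →+* 𝓕.𝒪)).comp (algebraMap 𝓕.Λ 𝓕.R) ∈ D) :
    HasOrdinaryCompanion 𝓕 F' hcpt' S' (𝓕.j.comp (𝓕.x : 𝓕.R →+* 𝓕.𝒪)) :=
  hD _ hmem

/-- **J3 (commutative algebra).**  For an integral extension `Λ ↪ R` and an algebraically closed field
`L`, every ring homomorphism `κ : Λ → L` extends to `R`: a prime `Q` of `R` lies over `ker κ`
(Mathlib `Ideal.exists_ideal_over_prime_of_isIntegral`), and the embedding `Λ/ker κ ↪ L` extends along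
the algebraic extension of domains `Λ/ker κ ↪ R/Q` (Mathlib `IsAlgClosed.lift`). -/
theorem exists_ringHom_comp_algebraMap_eq {Λ R L : Type*} [CommRing Λ] [CommRing R] [Algebra Λ R]
    [Algebra.IsIntegral Λ R] [Field L] [IsAlgClosed L]
    (hinj : Function.Injective (algebraMap Λ R)) (κ : Λ →+* L) :
    ∃ y : R →+* L, y.comp (algebraMap Λ R) = κ := by
  classical
  haveI : (RingHom.ker κ).IsPrime := RingHom.ker_isPrime κ
  have hbot : (⊥ : Ideal R).comap (algebraMap Λ R) ≤ RingHom.ker κ := by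
    intro a ha
    simp only [Ideal.mem_comap, Ideal.mem_bot] at ha
    have : a = 0 := hinj (by rw [ha, map_zero])
    simp [this]
  obtain ⟨Q, -, hQprime, hQ⟩ :=
    Ideal.exists_ideal_over_prime_of_isIntegral (RingHom.ker κ) (⊥ : Ideal R) hbot
  haveI : Q.IsPrime := hQprime
  have hker : ∀ a ∈ Q.comap (algebraMap Λ R), κ a = 0 := fun a ha => by
    rwa [hQ, RingHom.mem_ker] at ha
  let κ' : Λ ⧸ Q.comap (algebraMap Λ R) →+* L := Ideal.Quotient.lift _ κ hker
  have hκ'inj : Function.Injective κ' :=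
    RingHom.lift_injective_of_ker_le_ideal _ hker (le_of_eq hQ.symm)
  letI : Algebra (Λ ⧸ Q.comap (algebraMap Λ R)) L := κ'.toAlgebra
  haveI : IsDomain (Λ ⧸ Q.comap (algebraMap Λ R)) := Ideal.Quotient.isDomain _
  haveI : IsDomain (R ⧸ Q) := Ideal.Quotient.isDomain Q
  haveI : Module.IsTorsionFree (Λ ⧸ Q.comap (algebraMap Λ R)) L :=
    (Module.isTorsionFree_iff_algebraMap_injective).2 hκ'inj
  haveI : Module.IsTorsionFree (Λ ⧸ Q.comap (algebraMap Λ R)) (R ⧸ Q) :=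
    (Module.isTorsionFree_iff_algebraMap_injective).2 Ideal.algebraMap_quotient_injective
  haveI : Algebra.IsAlgebraic (Λ ⧸ Q.comap (algebraMap Λ R)) (R ⧸ Q) := Algebra.IsIntegral.isAlgebraic
  let y' : (R ⧸ Q) →ₐ[Λ ⧸ Q.comap (algebraMap Λ R)] L := IsAlgClosed.lift
  refine ⟨y'.toRingHom.comp (Ideal.Quotient.mk Q), ?_⟩
  ext a
  have h1 : (Ideal.Quotient.mk Q) (algebraMap Λ R a) =
      algebraMap (Λ ⧸ Q.comap (algebraMap Λ R)) (R ⧸ Q) (Ideal.Quotient.mk _ a) := rfl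
  simp only [RingHom.coe_comp, Function.comp_apply, AlgHom.toRingHom_eq_coe, AlgHom.coe_toRingHom]
  rw [h1, AlgHom.commutes]
  change κ' (Ideal.Quotient.mk _ a) = κ a
  simp [κ']

/-- **J3 for the stub.**  Under the hypotheses of `T.stub_companions` (`Module.Finite 𝓕.Λ 𝓕.R`,
`4 ≤ dim 𝓕.R`; with `𝓕.dim_le : dim Λ ≤ 4` the dominance lemma makes `Λ → R` injective) EVERY weight
`κ : 𝓕.Λ → ℚ̄₃` has a `ℚ̄₃`-point of `𝓕.R` over it.  Hence the companion clause
`∀ y, y ∘ (Λ → R) ∈ D → HasOrdinaryCompanion …` can never be discharged vacuously: whatever non-empty `D`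
is chosen, a genuine `CuspidalAutomorphicRepData 3 F' hcpt'` must be produced (Disproof F2: none is
constructible in the tree). -/
theorem exists_point_over (𝓕 : OrdFamily f ι e S₀ ρC) [Module.Finite 𝓕.Λ 𝓕.R]
    (hdim : ((4 : ℕ) : WithBot ℕ∞) ≤ ringKrullDim 𝓕.R) (κ : 𝓕.Λ →+* PadicAlgCl 3) :
    ∃ y : 𝓕.R →+* PadicAlgCl 3, y.comp (algebraMap 𝓕.Λ 𝓕.R) = κ :=
  exists_ringHom_comp_algebraMap_eq (algebraMap_injective_of_ringKrullDim_le 𝓕.dim_le hdim) κ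

/-! ## 2. The reduction: `T.stub_companions` is exactly MF1 + MF2 + G1 + G3 -/

/-- A labelled weight with gaps `≥ 2` is dominant. -/
theorem isDominant_of_gaps {L : Type*} [Field L] [TopologicalSpace L] {A : Type*} [CommRing A]
    [TopologicalSpace A] (wt : LabelledWeight L A 3)
    (h : ∀ (τ : HodgeTateLabel L A) (i j : Fin 3), i < j → wt τ j + 2 ≤ wt τ i) : wt.IsDominant := by
  intro τ i j hij
  rcases hij.lt_or_eq with hlt | rfl
  · have := h τ i j hlt
    omega
  · exact le_rfl

/-- For an `𝔪_R`-adically continuous point `y`, the entries of `ρ_y = y ∘ 𝓕.ρ` reduce to those of the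
heart: `‖cast (r̄_f^B(σ))ᵢⱼ - (ρ_y σ)ᵢⱼ‖ < 1` (the entry minus a lift of its reduction lies in
`ker π = 𝔪_R`, on which `y` has norm `< 1`). -/
theorem norm_cast_rbar_sub_pointRep_lt_one (𝓕 : OrdFamily f ι e S₀ ρC) (y : 𝓕.R →+* PadicAlgCl 3)
    (hcont : ∀ N : ℕ, ∃ M : ℕ, ∀ r ∈ IsLocalRing.maximalIdeal 𝓕.R ^ M, ‖y r‖ ≤ ((3 : ℝ)⁻¹) ^ N)
    (σ : absoluteGaloisGroup K) (i j : Fin 3) :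
    ‖(ZMod.cast ((rbar f 𝓕.B σ).val i j) : PadicAlgCl 3) - (pointRep 𝓕 y σ).val i j‖ < 1 := by
  set r : 𝓕.R := (𝓕.ρ σ).val i j with hr
  set n : ZMod 3 := (rbar f 𝓕.B σ).val i j with hn
  have hπr : 𝓕.π r = n := by
    have h := congrFun (congrFun (𝓕.residual σ) i) j
    simpa [Matrix.map_apply] using h
  have hker : RingHom.ker 𝓕.π = IsLocalRing.maximalIdeal 𝓕.R :=
    IsLocalRing.eq_maximalIdeal (RingHom.ker_isMaximal_of_surjective 𝓕.π 𝓕.π_surjective)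
  have hmem : r - (n.val : 𝓕.R) ∈ IsLocalRing.maximalIdeal 𝓕.R := by
    rw [← hker, RingHom.mem_ker, map_sub, map_natCast, hπr, ZMod.natCast_zmod_val, sub_self]
  obtain ⟨M, hM⟩ := hcont 1
  have hpowle : ‖y (r - (n.val : 𝓕.R))‖ ^ M ≤ (3 : ℝ)⁻¹ := by
    rw [← norm_pow, ← map_pow]
    simpa using hM _ (Ideal.pow_mem_pow hmem M)
  have hlt : ‖y (r - (n.val : 𝓕.R))‖ < 1 := by
    refine lt_of_not_ge fun hge => ?_
    have h1 : (1 : ℝ) ≤ ‖y (r - (n.val : 𝓕.R))‖ ^ M := one_le_pow₀ hge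
    linarith
  have hy : y (n.val : 𝓕.R) = (ZMod.cast n : PadicAlgCl 3) := by
    rw [map_natCast, ZMod.cast_eq_val]
  calc ‖(ZMod.cast n : PadicAlgCl 3) - (pointRep 𝓕 y σ).val i j‖
      = ‖y (r - (n.val : 𝓕.R))‖ := by rw [pointRep_val_apply, map_sub, hy, norm_sub_rev]
    _ < 1 := hlt

/-- The ultrametric chain of three congruences modulo the maximal ideal of `ℤ̄₃`: if `a ≡ b ≡ c ≡ d`
(each difference of norm `< 1` in `ℚ̄₃`) then `a ≡ d`. -/
theorem norm_sub_lt_one_chain₃ (a b c d : PadicAlgCl 3) (hab : ‖a - b‖ < 1) (hbc : ‖b - c‖ < 1)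
    (hcd : ‖c - d‖ < 1) : ‖a - d‖ < 1 := by
  have habc : ‖a - c‖ < 1 := by
    have := IsUltrametricDist.dist_triangle_max a b c
    rw [dist_eq_norm, dist_eq_norm, dist_eq_norm] at this
    exact lt_of_le_of_lt this (max_lt hab hbc)
  have := IsUltrametricDist.dist_triangle_max a c d
  rw [dist_eq_norm, dist_eq_norm, dist_eq_norm] at this
  exact lt_of_le_of_lt this (max_lt habc hcd)

/-- **`stub_companions` reduced to the wall.**  `T.stub_companions` follows from MF1 (Hida theory on the
definite unitary group, GL₃-level), MF2 (the ordinary polarized seed), G1 (the auxiliary CM field) and G3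
(the Galois side: arithmetic weights near `x_C` and the shape of the points over them): choose `F'` by G1,
`hcpt'` by the tree's `isCompact_glFiniteIntegralLevel_holds`, `S'` and the seed by MF2, `D`, `E` by G3; for
a point `y` over
`D`, G3 gives continuity, integrality, the polarization of `ρ_y|Γ_{F'}` and its Borel shape of a gap-`≥ 2`
weight `λ(y)` at every `w ∣ 3`; MF1 applied to the seed of MF2 and to the weight family `λ(y)` (dominant
by `isDominant_of_gaps`, admissible with witness `ρ_y|Γ_{F'}`) gives `(P, r)` with clauses (a)–(c), (e);
clause (d) is the ultrametric chain `g⁻¹ r g ≡ r₀ ≡ cast r̄_f^B ≡ ρ_y` (MF1, MF2,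
`norm_cast_rbar_sub_pointRep_lt_one`). -/
theorem stub_companions_of : Missing.hidaOrdinaryCompanions → Missing.ordinaryPolarizedSeed → Missing.auxiliaryCMField → Missing.arithmeticPointsNearPicard → T.stub_companions := by
  intro hMF1 hMF2 hG1 hG3 f ι e S₀ ρC 𝓕 hgen hin hM hdim hpur hfin
  obtain ⟨F', iF, iN, iA, iG, iCM, hdeg, hrange, hunr, hsplit⟩ := hG1 f ι e S₀ ρC 𝓕 hgen hin hM
  have hcpt' : isCompact_glFiniteIntegralLevel 3 F' := isCompact_glFiniteIntegralLevel_holds 3 F'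
  obtain ⟨D, E, hE, hint, hacc, hpts⟩ := hG3 f ι e S₀ ρC 𝓕 hgen hin hM hdim hpur hfin F' hdeg hsplit
  obtain ⟨S', P₀, r₀, hS', hP₀, hirr, hcompat₀, hunr₀, hpol₀, hpur₀, haux₀, hred₀, hord₀⟩ :=
    hMF2 f ι e S₀ ρC 𝓕 hgen hin hM hpur F' hcpt' hdeg hrange hunr hsplit
  refine ⟨F', iF, iN, iA, iG, hcpt', S', D, E, hdeg, iCM, hrange, hE, hS', hint, hacc, ?_⟩
  intro y hy
  obtain ⟨hcont, hyint, hpolar, wt, hwt⟩ := hpts y hy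
  -- MF1 on the seed and the weight family of `y`
  have hdom : ∀ w : HeightOneSpectrum (𝓞 F'), ((3 : ℕ) : 𝓞 F') ∈ w.asIdeal → (wt w).IsDominant :=
    fun w hw => isDominant_of_gaps (wt w) (hwt w hw).1
  have hwit : ∃ ρ : absoluteGaloisGroup F' →* GL (Fin 3) (PadicAlgCl 3), TracePolarizedHom F' 𝓕.m ρ ∧
      ∀ w : HeightOneSpectrum (𝓞 F'), ((3 : ℕ) : 𝓞 F') ∈ w.asIdeal →
        ∀ art : LocalArtinData (w.adicCompletion F'), art.IsCanonical →
          IsBorelOfWeightAt F' w art ρ (wt w) :=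
    ⟨_, hpolar, fun w hw art hart => (hwt w hw).2 art hart⟩
  obtain ⟨P, r, hP, hcompat, -, hpol, hpurr, ⟨g, hcong⟩, hord⟩ :=
    hMF1 F' ι hcpt' S' 𝓕.m hunr hsplit P₀ r₀ hP₀ hirr hcompat₀ hunr₀ hpol₀ hpur₀ haux₀
      (fun σ i j => (hred₀ σ i j).1) hord₀ wt hdom hwit
  refine ⟨P, r, hP, hcompat, hpol, hpurr, hcont, hyint, ⟨g, fun σ i j => ⟨(hcong σ i j).1, ?_⟩⟩, ?_⟩
  · -- clause (d): the ultrametric chain `g⁻¹ r g ≡ r₀ ≡ cast r̄ ≡ ρ_y`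
    exact norm_sub_lt_one_chain₃ _ _ _ _ (hcong σ i j).2 (hred₀ σ i j).2
      (norm_cast_rbar_sub_pointRep_lt_one 𝓕 y hcont (absGaloisRestrict K F' σ) i j)
  · -- clause (e): the same gap-`≥ 2` weight for `r` (MF1) and for `ρ_y` (G3)
    intro w hw art hart
    refine ⟨wt w, (hwt w hw).1, hord w hw art hart, ?_⟩
    obtain ⟨g', U, hup, hdiag⟩ := (hwt w hw).2 art hart
    exact ⟨g', U, hup, hdiag⟩

end

end Summit.Langlands.Langlands.Cruxes.MuOrdinaryFamilyRT.ThorneMinimalLift
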